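import Summits.BirchSwinnertonDyer.BirchSwinnertonDyer.Theorems.CyclotomicUntwistFormalEndomorphismDigits
import Summits.BirchSwinnertonDyer.BirchSwinnertonDyer.Theorems.CyclotomicUntwistPadicDigitLimit
import HarnessLib

/-!
# Route `CyclotomicUntwist`: endomorphisms of the formal group, III — the digit datum of a `ℤ_p`-lift:
# `H̄ = F̄(F̄([a_J](X), [b_J](Xᵖ)), [p^J](g_J))` with `a_J → A`, `b_J → B` in `ℤ_p` (binder `hDig` of the
# `H3_ss` assembly of the registered stub S2k `stub_KATZ_rankLeTwo_supersingular`)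

Cell `pub/bsd-wall` (D-0145 line `route-BirchSwinnertonDyer-CyclotomicUntwist` rev 9), prover seat
`bsd-line-cycu-p2` (gen 7), sub-package «W3-core» of S2k (lines of record `Lines/dfrob_wan.lean` on K1 =
stmt-BirchSwinnertonDyer-21580, `Lines/dfrob_kato.lean` on K2 = 21581). THEOREMS ONLY (no definition, no named fact,
no `sorry`); helper `--supports` 21580; BSD is not proved by this file and no crux or stub is. Sequel of parts I
(`…FormalEndomorphismAlgebra`) and II (`…FormalEndomorphismDigits`: the digit expansion over `𝔽_p` and the
supersingular datum `π² ∈ [p]∘End(F̄)`).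

* `exists_partialSum_eq_add`, **`exists_padicInt_partialSum_sub_norm_le`**: the partial sums `∑_{j<J} pʲ·d j`
  (`d : ℕ → ℕ`) converge in `ℤ_p` to some `A` with the sharp rate `‖∑_{j<J} pʲ d j − A‖ ≤ p^{−J}` (completeness of
  `ℤ_p`; ultrametric telescoping);
* `exists_digits_of_map_toZMod_hom_of_datum` — the same packaging PARAMETRIC in the datum `π² = [p]∘e` (for
  fibres where it is supplied otherwise, e.g. the ordinary lane of cycu-p5 g11);
* **`exists_digits_of_map_toZMod_hom`** — THE BINDER `hDig` of cycu-p4's bridge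
  `CyclotomicUntwistPadicDigitLimit.padicRankTwo_of_honda_of_digits` (p639390) VERBATIM, for `V/ℤ_p` with elliptic
  generic and special fibres and `p ∣ t = p + 1 − #Ṽ(𝔽_p)`: every `H ∈ Xℤ_p⟦X⟧` whose reduction is an endomorphism
  of `F̄` has `A, B ∈ ℤ_p`, `a b : ℕ → ℕ` with `‖a_J − A‖, ‖b_J − B‖ ≤ p^{−J}`, and `g : ℕ → X𝔽_p⟦X⟧` with
  `H̄ = F̄(F̄([a_J](X), [b_J](Xᵖ)), [p^J](g_J))` for every `J`; `exists_digits_of_map_toZMod_hom'` also records that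
  the `g_J` are endomorphisms. («`H̄ = [A] ⊕ [B]π` in `End(F̄) = ℤ_p[π]`» — Katz's rank `2`, in digits.)
* `padicRankTwo_of_honda` — cycu-p4's bridge `PadicDigitLimit.padicRankTwo_of_honda_of_digits` with `hDig`
  DISCHARGED: per curve `V/ℤ_p` (`p` odd, `p ∣ t`), Katz's rank `2` over `ℤ_p` from Honda's W1 alone.
With cycu-p3's W1 (`KatzRankSupersingular.honda_step`) and cycu-p4's `stub_KATZ_rankLeTwo_supersingular_of_digits`
(p639930, `hDigAll → S2k`), `hDigAll := fun V₀ _ _ hV₀ => exists_digits_of_map_toZMod_hom V₀ hV₀` closes S2k (landed by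
name by cycu-p4 per the lead); nothing here asserts S2k.

References: [cite: Katz1981CrystallineDieudonne, Thm. 5.3.3 and §5.3]; [cite: SilvermanAEC2009, IV.7.4, V.2.3.1(b)].
-/

set_option autoImplicit false
-- single-conjunct summit: `Summit.BirchSwinnertonDyer.BirchSwinnertonDyer.…` repeats the name by design
set_option linter.dupNamespace false

noncomputable section

open PowerSeries Literature.NumberTheory.EllipticCurves
  Summit.BirchSwinnertonDyer.BirchSwinnertonDyer.Theorems.FormalEndomorphismAlgebra
  Summit.BirchSwinnertonDyer.BirchSwinnertonDyer.Theorems.FormalEndomorphismDigits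

namespace Summit.BirchSwinnertonDyer.BirchSwinnertonDyer.Theorems.FormalEndomorphismPadicDigits

/-! ## The `p`-adic integers `A = ∑ pʲ·da j`, `B = ∑ pʲ·db j` and the digit datum of a `ℤ_p`-lift -/

section Padic

variable {p : ℕ} [hp : Fact p.Prime]

omit hp in
/-- Partial sums of `∑ pʲ·d j` differ by multiples of `p^J`. [folklore] -/
theorem exists_partialSum_eq_add (d : ℕ → ℕ) {J m : ℕ} (hJm : J ≤ m) :
    ∃ N : ℕ, ∑ j ∈ Finset.range m, p ^ j * d j = ∑ j ∈ Finset.range J, p ^ j * d j + p ^ J * N := by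
  induction m, hJm using Nat.le_induction with
  | base => exact ⟨0, by simp⟩
  | succ m hJm ih =>
    obtain ⟨N, hN⟩ := ih
    refine ⟨N + p ^ (m - J) * d m, ?_⟩
    rw [Finset.sum_range_succ, hN, mul_add, ← mul_assoc, ← pow_add, Nat.add_sub_cancel' hJm]
    ring

/-- **The partial sums `∑_{j<J} pʲ·d j` converge in `ℤ_p`**, with the sharp rate: there is `A ∈ ℤ_p` with
`‖∑_{j<J} pʲ d j − A‖ ≤ p^{−J}` for every `J`. [folklore] -/
theorem exists_padicInt_partialSum_sub_norm_le (d : ℕ → ℕ) :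
    ∃ A : ℤ_[p], ∀ J : ℕ, ‖((∑ j ∈ Finset.range J, p ^ j * d j : ℕ) : ℤ_[p]) - A‖ ≤ (p : ℝ) ^ (-(J : ℤ)) := by
  set u : ℕ → ℤ_[p] := fun J => ((∑ j ∈ Finset.range J, p ^ j * d j : ℕ) : ℤ_[p]) with hu
  have hp1 : 1 < (p : ℝ) := by exact_mod_cast hp.out.one_lt
  have hp0 : 0 < (p : ℝ) := by positivity
  -- `‖u m − u J‖ ≤ p^{-J}` for `J ≤ m`
  have hkey : ∀ J m : ℕ, J ≤ m → ‖u m - u J‖ ≤ (p : ℝ) ^ (-(J : ℤ)) := by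
    intro J m hJm
    obtain ⟨N, hN⟩ := exists_partialSum_eq_add (p := p) d hJm
    have e : u m - u J = ((p : ℤ_[p]) ^ J) * (N : ℤ_[p]) := by
      simp only [hu, hN]; push_cast; ring
    rw [e, norm_mul, PadicInt.norm_p_pow]
    exact mul_le_of_le_one_right (by positivity) (PadicInt.norm_le_one _)
  have hcau : CauchySeq u := by
    refine cauchySeq_of_le_geometric ((p : ℝ)⁻¹) 1 (inv_lt_one_of_one_lt₀ hp1) fun n => ?_
    rw [dist_comm, dist_eq_norm, one_mul, inv_pow, ← zpow_natCast, ← zpow_neg]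
    exact hkey n (n + 1) (Nat.le_succ n)
  obtain ⟨A, hA⟩ := cauchySeq_tendsto_of_complete hcau
  refine ⟨A, fun J => ?_⟩
  have hlim : Filter.Tendsto (fun m => ‖u J - u m‖) Filter.atTop (nhds ‖u J - A‖) :=
    (tendsto_const_nhds.sub hA).norm
  refine le_of_tendsto hlim (Filter.eventually_atTop.2 ⟨J, fun m hm => ?_⟩)
  rw [norm_sub_rev]
  exact hkey J m hm

variable (V : WeierstrassCurve ℤ_[p]) [hE : (V.map PadicInt.Coe.ringHom).IsElliptic] [hEt : (V.map PadicInt.toZMod).IsElliptic]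

omit hE hEt in
/-- **The digit datum, PARAMETRIC in the datum `π² = [p] ∘ e`** (`e ∈ End(F̄)`, `[p](e(X)) = X^{p²}`; supplied on
fibres with `p ∣ t` by `exists_hom_formalMul_subst_eq_X_pow_sq`, and by other means elsewhere): for every
`H ∈ Xℤ_p⟦X⟧` with `H̄ ∈ End(F̄)`, `p`-adic integers `A, B`, naturals `a_J → A`, `b_J → B` at rate `p^{−J}`, and
series `g_J` with `H̄ = F̄(F̄([a_J](X), [b_J](Xᵖ)), [p^J](g_J))` for every `J`. [cite: Katz1981CrystallineDieudonne, §5.3] -/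
theorem exists_digits_of_map_toZMod_hom_of_datum {e : (ZMod p)⟦X⟧} (he0 : constantCoeff e = 0)
    (he : e.subst (V.map PadicInt.toZMod).formalGroupLaw =
      MvPowerSeries.subst ![e.subst (MvPowerSeries.X 0 : MvPowerSeries (Fin 2) (ZMod p)),
        e.subst (MvPowerSeries.X 1 : MvPowerSeries (Fin 2) (ZMod p))] (V.map PadicInt.toZMod).formalGroupLaw)
    (hπ : ((V.map PadicInt.toZMod).formalMul p).subst e = (PowerSeries.X : (ZMod p)⟦X⟧) ^ p ^ 2)
    (H : ℤ_[p]⟦X⟧) (hH0 : constantCoeff H = 0)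
    (hH : (H.map PadicInt.toZMod).subst (V.map PadicInt.toZMod).formalGroupLaw =
      MvPowerSeries.subst ![(H.map PadicInt.toZMod).subst (MvPowerSeries.X 0 : MvPowerSeries (Fin 2) (ZMod p)),
        (H.map PadicInt.toZMod).subst (MvPowerSeries.X 1 : MvPowerSeries (Fin 2) (ZMod p))]
        (V.map PadicInt.toZMod).formalGroupLaw) :
    ∃ (A B : ℤ_[p]) (a b : ℕ → ℕ) (g : ℕ → (ZMod p)⟦X⟧),
      (∀ J, constantCoeff (g J) = 0 ∧ (g J).subst (V.map PadicInt.toZMod).formalGroupLaw =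
        MvPowerSeries.subst ![(g J).subst (MvPowerSeries.X 0 : MvPowerSeries (Fin 2) (ZMod p)),
          (g J).subst (MvPowerSeries.X 1 : MvPowerSeries (Fin 2) (ZMod p))] (V.map PadicInt.toZMod).formalGroupLaw) ∧
      (∀ J, ‖((a J : ℤ_[p]) - A)‖ ≤ (p : ℝ) ^ (-(J : ℤ)) ∧ ‖((b J : ℤ_[p]) - B)‖ ≤ (p : ℝ) ^ (-(J : ℤ))) ∧
      ∀ J, H.map PadicInt.toZMod = MvPowerSeries.subst ![MvPowerSeries.subst ![(V.map PadicInt.toZMod).formalMul (a J),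
          expand p hp.out.ne_zero ((V.map PadicInt.toZMod).formalMul (b J))] (V.map PadicInt.toZMod).formalGroupLaw,
        ((V.map PadicInt.toZMod).formalMul (p ^ J)).subst (g J)] (V.map PadicInt.toZMod).formalGroupLaw := by
  have hh0 : constantCoeff (H.map PadicInt.toZMod) = 0 := by
    rw [← PowerSeries.coeff_zero_eq_constantCoeff_apply, PowerSeries.coeff_map, PowerSeries.coeff_zero_eq_constantCoeff_apply,
      hH0, map_zero]
  obtain ⟨da, db, g, hg, hJ⟩ := exists_digitExpansion (V.map PadicInt.toZMod) he0 he hπ hh0 hH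
  obtain ⟨A, hA⟩ := exists_padicInt_partialSum_sub_norm_le (p := p) da
  obtain ⟨B, hB⟩ := exists_padicInt_partialSum_sub_norm_le (p := p) db
  exact ⟨A, B, fun J => ∑ j ∈ Finset.range J, p ^ j * da j, fun J => ∑ j ∈ Finset.range J, p ^ j * db j, g,
    hg, fun J => ⟨hA J, hB J⟩, hJ⟩

/-- **THE DIGIT DATUM of an endomorphism of the reduced formal group** (binder `hDig` of the `H3_ss` assembly,
`CyclotomicUntwistPadicDigitLimit.padicRankTwo_of_honda_of_digits`, cycu-p4 g8). For `V/ℤ_p` with elliptic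
generic and special fibres and `p ∣ t = p + 1 − #Ṽ(𝔽_p)`, every `H ∈ Xℤ_p⟦X⟧` whose reduction `H̄` is an
endomorphism of `F̄` admits `A, B ∈ ℤ_p`, natural numbers `a_J → A`, `b_J → B` (`‖a_J − A‖, ‖b_J − B‖ ≤ p^{−J}`)
and series `g_J ∈ X𝔽_p⟦X⟧` (endomorphisms, not recorded) with `H̄ = F̄(F̄([a_J](X), [b_J](Xᵖ)), [p^J](g_J))` for
every `J` — «`H̄ = [A] ⊕ [B]π` in `End(F̄) = ℤ_p[π]`», Katz's rank `2` for the height-`2` formal group, in digits.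
[cite: Katz1981CrystallineDieudonne, Thm. 5.3.3 and §5.3] [cite: SilvermanAEC2009, IV.7.4 and V.2.3.1] -/
theorem exists_digits_of_map_toZMod_hom
    (hdvd : (p : ℤ) ∣ Literature.NumberTheory.EllipticCurves.HasseManin.tr (V.map PadicInt.toZMod))
    (H : ℤ_[p]⟦X⟧) (hH0 : constantCoeff H = 0)
    (hH : (H.map PadicInt.toZMod).subst (V.map PadicInt.toZMod).formalGroupLaw =
      MvPowerSeries.subst ![(H.map PadicInt.toZMod).subst (MvPowerSeries.X 0 : MvPowerSeries (Fin 2) (ZMod p)),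
        (H.map PadicInt.toZMod).subst (MvPowerSeries.X 1 : MvPowerSeries (Fin 2) (ZMod p))]
        (V.map PadicInt.toZMod).formalGroupLaw) :
    ∃ (A B : ℤ_[p]) (a b : ℕ → ℕ) (g : ℕ → (ZMod p)⟦X⟧), (∀ J, constantCoeff (g J) = 0) ∧
      (∀ J, ‖((a J : ℤ_[p]) - A)‖ ≤ (p : ℝ) ^ (-(J : ℤ)) ∧ ‖((b J : ℤ_[p]) - B)‖ ≤ (p : ℝ) ^ (-(J : ℤ))) ∧
      ∀ J, H.map PadicInt.toZMod = MvPowerSeries.subst ![MvPowerSeries.subst ![(V.map PadicInt.toZMod).formalMul (a J),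
          expand p hp.out.ne_zero ((V.map PadicInt.toZMod).formalMul (b J))] (V.map PadicInt.toZMod).formalGroupLaw,
        ((V.map PadicInt.toZMod).formalMul (p ^ J)).subst (g J)] (V.map PadicInt.toZMod).formalGroupLaw := by
  obtain ⟨e, he0, he, hπ⟩ := exists_hom_formalMul_subst_eq_X_pow_sq V hdvd
  obtain ⟨A, B, a, b, g, hg, hAB, hJ⟩ := exists_digits_of_map_toZMod_hom_of_datum V he0 he hπ H hH0 hH
  exact ⟨A, B, a, b, g, fun J => (hg J).1, hAB, hJ⟩

/-- The same with the endomorphism property of the remainders `g_J` recorded. [cite: Katz1981CrystallineDieudonne, §5.3] -/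
theorem exists_digits_of_map_toZMod_hom'
    (hdvd : (p : ℤ) ∣ Literature.NumberTheory.EllipticCurves.HasseManin.tr (V.map PadicInt.toZMod))
    (H : ℤ_[p]⟦X⟧) (hH0 : constantCoeff H = 0)
    (hH : (H.map PadicInt.toZMod).subst (V.map PadicInt.toZMod).formalGroupLaw =
      MvPowerSeries.subst ![(H.map PadicInt.toZMod).subst (MvPowerSeries.X 0 : MvPowerSeries (Fin 2) (ZMod p)),
        (H.map PadicInt.toZMod).subst (MvPowerSeries.X 1 : MvPowerSeries (Fin 2) (ZMod p))]
        (V.map PadicInt.toZMod).formalGroupLaw) :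
    ∃ (A B : ℤ_[p]) (a b : ℕ → ℕ) (g : ℕ → (ZMod p)⟦X⟧),
      (∀ J, constantCoeff (g J) = 0 ∧ (g J).subst (V.map PadicInt.toZMod).formalGroupLaw =
        MvPowerSeries.subst ![(g J).subst (MvPowerSeries.X 0 : MvPowerSeries (Fin 2) (ZMod p)),
          (g J).subst (MvPowerSeries.X 1 : MvPowerSeries (Fin 2) (ZMod p))] (V.map PadicInt.toZMod).formalGroupLaw) ∧
      (∀ J, ‖((a J : ℤ_[p]) - A)‖ ≤ (p : ℝ) ^ (-(J : ℤ)) ∧ ‖((b J : ℤ_[p]) - B)‖ ≤ (p : ℝ) ^ (-(J : ℤ))) ∧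
      ∀ J, H.map PadicInt.toZMod = MvPowerSeries.subst ![MvPowerSeries.subst ![(V.map PadicInt.toZMod).formalMul (a J),
          expand p hp.out.ne_zero ((V.map PadicInt.toZMod).formalMul (b J))] (V.map PadicInt.toZMod).formalGroupLaw,
        ((V.map PadicInt.toZMod).formalMul (p ^ J)).subst (g J)] (V.map PadicInt.toZMod).formalGroupLaw := by
  obtain ⟨e, he0, he, hπ⟩ := exists_hom_formalMul_subst_eq_X_pow_sq V hdvd
  exact exists_digits_of_map_toZMod_hom_of_datum V he0 he hπ H hH0 hH

end Padic

/-! ## Composition: the H3 body per curve from Honda's W1 alone (cycu-p4's bridge with `hDig` discharged) -/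

section Composition

variable {p : ℕ} [hp : Fact p.Prime] (V : WeierstrassCurve ℤ_[p]) [hE : (V.map PadicInt.Coe.ringHom).IsElliptic]
  [hEt : (V.map PadicInt.toZMod).IsElliptic]

/-- **Katz's rank `2` over `ℤ_p`, per supersingular curve, FROM HONDA'S EXPONENTIAL FORM ALONE.** For `V/ℤ_p`
(`p` odd, elliptic fibres, `p ∣ t`), granted W1 «every second-kind `g` has `pᵏ g = log ∘ h` with `h` integral»,
every second-kind `g ∈ Xℚ_p⟦X⟧` is `≡ a·log + b·log(Xᵖ)` modulo bounded denominators — cycu-p4's bridge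
`PadicDigitLimit.padicRankTwo_of_honda_of_digits` with its digit binder `hDig` DISCHARGED by
`exists_digits_of_map_toZMod_hom`. [cite: Katz1981CrystallineDieudonne, Thm. 5.3.3] -/
theorem padicRankTwo_of_honda (hp2 : p ≠ 2)
    (hdvd : (p : ℤ) ∣ Literature.NumberTheory.EllipticCurves.HasseManin.tr (V.map PadicInt.toZMod))
    (hW1 : ∀ g : ℚ_[p]⟦X⟧, constantCoeff g = 0 →
      (∃ d : ℕ, ∀ n : ℕ, ‖(p : ℚ_[p]) ^ d * ((n : ℚ_[p]) * coeff n g)‖ ≤ 1) →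
      (∃ d' : ℕ, ∀ e : Fin 2 →₀ ℕ, ‖(p : ℚ_[p]) ^ d' * MvPowerSeries.coeff e
        (g.subst (V.map PadicInt.Coe.ringHom).formalGroupLaw - g.subst (MvPowerSeries.X 0) -
          g.subst (MvPowerSeries.X 1))‖ ≤ 1) →
      ∃ (k : ℕ) (h : ℚ_[p]⟦X⟧), constantCoeff h = 0 ∧ IsPadicInt h ∧
        (V.map PadicInt.Coe.ringHom).formalLog.subst h = C ((p : ℚ_[p]) ^ k) * g) :
    ∀ g : ℚ_[p]⟦X⟧, constantCoeff g = 0 →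
      (∃ d : ℕ, ∀ n : ℕ, ‖(p : ℚ_[p]) ^ d * ((n : ℚ_[p]) * coeff n g)‖ ≤ 1) →
      (∃ d' : ℕ, ∀ e : Fin 2 →₀ ℕ, ‖(p : ℚ_[p]) ^ d' * MvPowerSeries.coeff e
        (g.subst (V.map PadicInt.Coe.ringHom).formalGroupLaw - g.subst (MvPowerSeries.X 0) -
          g.subst (MvPowerSeries.X 1))‖ ≤ 1) →
      ∃ a b : ℚ_[p], ∃ d'' : ℕ, ∀ n : ℕ, ‖(p : ℚ_[p]) ^ d'' * coeff n
        (g - C a * (V.map PadicInt.Coe.ringHom).formalLog -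
          C b * expand p hp.out.ne_zero (V.map PadicInt.Coe.ringHom).formalLog)‖ ≤ 1 :=
  PadicDigitLimit.padicRankTwo_of_honda_of_digits V hp2 hW1
    (fun H hH0 hH => exists_digits_of_map_toZMod_hom V hdvd H hH0 hH)

end Composition


end Summit.BirchSwinnertonDyer.BirchSwinnertonDyer.Theorems.FormalEndomorphismPadicDigits

end
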